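import Summits.NavierStokesRegularity.FunctionalMining.SaturatingLawSup
import Summits.NavierStokesRegularity.FunctionalMining.TopEigProductionReverse
import Summits.NavierStokesRegularity.FunctionalMining.PressureFunctional
import HarnessLib

/-!
# FunctionalMining — the STATIC KILL CRITERION for the one-sided spectral rows
# `ES.lam1.q | T_LD` and `ES.neglam3.q | T_LD`
# (Lemma 0 (⇒) for `SaturatingLawSup`, and LEMMA S of the no-go seat's QN4-NOTE in kernel form)

Search for candidate a priori estimates; no regularity claim. Cell `pub-nsfunc`, no-go seat
(gen 30), staged as `pub-nsfunc-nogo/NoGo/TopEigSaturatingKill.STAGING.lean` v2 (sha256 122b2e12dd0fed58)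
and filed by the prove seat (gen 24) in TWO parts for the 400-line lint: §§1–5 in this file, §§6–7 in
`NoGo/TopEigSaturatingKillBot.lean` (declarations byte-identical to the staged file, same order).
Refutation BOOKKEEPING for CANDIDATE a priori inequalities; nothing about regularity.

The six rows `ES.lam1.q / ES.neglam3.q | T_LD` (`q = 2, 3, 4`) carry the non-smooth spectral
weights `Φ_q = ∫(λ₁⁺)^q(S)`, `Ψ_q = ∫((−λ₃)⁺)^q(S)`; their law is the one-sided-derivative-value form
`SaturatingLawSup` (`SaturatingLawSup.lean`), for which the tree's Lemma 0 (`SaturatingLawStatic`,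
`RateBudgets.initialRate_le_of_isRateBudget`) does not apply (no two-sided rates). This file gives
the kernel form of the no-go seat's kill chain for the `λ₁` rows, §§1–5, its mirror for the
`−λ₃` rows, §6, and, §7, LEMMA K in LARGE-VISCOSITY form — a family with a production floor, bounded
budgets and vanishing heat cost opens the door for EVERY constant `κ` (SIEVELD §0 Lemma 0 (⇒) +
QN4-NOTE §1 LEMMA S + §2 LEMMA K; the amplitude scaling of the pen LEMMA K is not needed for the
kernel kill, because `SaturatingLawSup` quantifies over every `ν > 0` and `γ > 0`):

* `TopEig.integrable_topEigDensity` — for smooth divergence-free `v`, real `q ≥ 1` and ANY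
  continuous direction field `M`, the Danskin density `x ↦ q λ₁^{q−1} μ(S(x); M(x))` is integrable
  (pointwise limit of continuous quotients, dominated by `q λ₁^{q−1}‖M‖`);
* `TopEig.dirTopEig_smul_add_ge` — **the compatible-selection inequality** (LEMMA S (c)): for a unit
  top vector `e` of `A` that MAXIMISES the heat form (`eᵀLe = μ(A; L)`), and every real `ν`,
  `ν μ(A; L) + eᵀXe ≤ μ(A; νL + X)`;
* `TopEig.eulerStrainVec w` — the Euler strain tendency at a datum,
  `E_w = −Π(π_w) − N(w) − Σₖ wₖ ∂ₖS(w)` (`π_w = pressureOf w` the datum's own pressure,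
  `PressureFunctional`), so that along Navier–Stokes from `w`: `Ṡ(0⁺) = νΔS(w) + E_w`
  (`StrainTensor.timeDerivWithin_strainFlat_eq`, `pressureOf_eq_pressure_sub_integral`);
* `TopEig.IsHeatMaxSelection w e` — `e(x)` a unit top vector of `S(w)(x)` maximising
  `eᵀ ΔS(w)(x) e` at every `x` (exists at every datum: `exists_isHeatMaxSelection`); and
  `TopEig.selEulerProduction q w e = 𝒫_q(w; e) := ∫ q λ₁^{q−1} e(x)ᵀ E_w(x) e(x) dx` — the Euler
  production of `Φ_q` THROUGH the selection (a static functional of the datum and the selection);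
* **`TopEig.selEulerProduction_sub_heat_le_integral`** (LEMMA S (ii), datum level): for every real
  `ν`, `𝒫_q(w; e) − ν·heatDissipation Φ_q w ≤ ∫ q λ₁^{q−1} μ(S; νS(Δw) + E_w)` (Danskin's formula for
  the heat dissipation, `TopEigHeatDanskin`, and the selection inequality pointwise);
* **`TopEig.selEulerProduction_sub_heat_le_initialRate`** (LEMMA S (i)+(ii) along Navier–Stokes):
  along every classical unforced solution on `[a, b]`, `s ↦ Φ_q(u s)` has at `s = a` a right
  derivative value `R` within `[a, b]` with `𝒫_q(u a; e) − ν·heatDissipation Φ_q (u a) ≤ R`;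
* **`SaturatingLawSup.lowerRate_le`** — Lemma 0 (⇒) for the one-sided law, GENERAL `F`: a number
  `L` that lies below some initial right-derivative value of `F` along EVERY classical solution
  issued from an admissible datum `u₀` (`ν > 0`) satisfies `L ≤ κ ν^{−γ} (2ℰ u₀) F(u₀)^{1+1/σ}`
  (local existence `Torus.exists_classicalNS_smooth`, mean conservation);
* **`SaturatingLawSup.selEulerProduction_sub_heat_le`** — hence, under
  `SaturatingLawSup Φ_q σ γ κ`: `𝒫_q(w; e) − ν T_q(w) ≤ κ ν^{−γ} (2ℰ w) Φ_q(w)^{1+1/σ}` at every smooth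
  divergence-free zero-mean datum `w` on `T³`, every heat-maximal selection `e`, every `ν > 0`;
* **`TopEigSelKillAt`, `not_topEigMoment_saturatingLawSup_of_selKillAt`** — the STATIC DOOR: one
  datum `w`, one `ν > 0` and one heat-maximal selection `e` with
  `κ ν^{−γ} (2ℰ w) Φ_q(w)^{1+1/σ} < 𝒫_q(w; e) − ν T_q(w)` refute `SaturatingLawSup Φ_q σ γ κ`; and
  `TopEigSelKill q σ γ → ∀ κ, ¬ SaturatingLawSup Φ_q σ γ κ`;
* §6, the `−λ₃` MIRROR (rows `ES.neglam3.q`): `IsHeatMaxBotSelection` (unit top vectors of `−S(w)`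
  maximising the heat form of `−S(Δw)`), `selEulerProductionBot q w e = ∫ q (−λ₃)^{q−1} eᵀ(−E_w)e`,
  `selEulerProductionBot_sub_heat_le_initialRate` (from `hasDerivWithinAt_negBotEigMoment_spaceTime`:
  the direction of `−S` along Navier–Stokes is `ν(−S(Δw)) + (−E_w)` — NOT the tendency of the datum
  `−w`, whose Euler part is again `E_w`), `SaturatingLawSup.selEulerProductionBot_sub_heat_le`, the
  doors `NegBotEigSelKillAt` / `NegBotEigSelKill` and `not_negBotEigMoment_saturatingLawSup_of_selKillAt`
  / `…_of_selKill`;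
* §7, **LEMMA K (large-viscosity form)**: `exists_nu_budget_lt_of_family` (elementary: `γ > 0`, a
  production floor `c > 0`, budgets in `[0, B]`, heat costs `≤ ε` for every `ε > 0` at some member ⇒
  for every real `κ` some `ν > 0` and some member satisfy `κ ν^{−γ} b < P − ν H`), hence
  **`topEigSelKill_of_family`** / **`negBotEigSelKill_of_family`** (an indexed family of admissible
  data and heat-maximal selections with (K-a) a production floor, (K-b) bounded budgets
  `(2ℰ w_i) Φ_q(w_i)^{1+1/σ} ≤ B`, (K-c) heat costs `heatDissipation Φ_q (w_i) ≤ ε` available for every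
  `ε > 0` gives `TopEigSelKill q σ γ`, resp. `NegBotEigSelKill q σ γ`, for every `γ > 0`) and
  **`not_topEigMoment_saturatingLawSup_of_family`** / **`not_negBotEigMoment_saturatingLawSup_of_family`**
  (`q ≥ 1`, `γ > 0`: such a family refutes `SaturatingLawSup Φ_q σ γ κ`, resp. `Ψ_q`, for EVERY `κ`).

What is NOT here (pen, QN4-NOTE of the no-go seat; kernel WANTED): the transport identity
`∫ q λ₁^{q−1} eᵀ((w·∇)S)e = 0` (LEMMA ADV — in the kernel the transport stays inside `E_w`), the
`ν`-wise pen LEMMA K (at every FIXED `ν`, by amplitude scaling `𝒫_q(αw; e) = α^{q+1}𝒫_q(w; e)`,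
`T_q(αw) = α^q T_q(w)`, under `1 + q/σ > 0` — the form LEAD RULING (τ)(2) asks of a pen witness; not
needed for `¬ SaturatingLawSup`), and the witness family W18 itself (`(F1)`: production floor,
bounded budgets and vanishing heat cost, with a MEASURABLE heat-maximal selection —
measurable-selection theorem, pen) — i.e. NO INSTANCE of `TopEigSelKill` / `NegBotEigSelKill` is
proved here and no row verdict is a kernel theorem by this file.
[ours, bookkeeping; Danskin folklore]
-/

noncomputable section

open MeasureTheory Set Filter Topology

namespace Summit.NavierStokesRegularity.FunctionalMining

open Literature.Analysis.FunctionSpaces Literature.Analysis.FluidPDE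

namespace TopEig

open StrainL4 StrainTensor

variable {d : Type*} [Fintype d] [DecidableEq d] [Nonempty d]

/-! ## 1. General Danskin densities are integrable -/

/-- `x ↦ μ(A(x); M(x))` is a.e.-strongly measurable for continuous matrix fields `A, M` (pointwise
limit of the continuous quotients `(λ(A + τM) − λ(A))/τ`, `τ → 0⁺`). [ours] -/
theorem aestronglyMeasurable_dirTopEig_comp {A M : UnitAddTorus d → EuclideanSpace ℝ (d × d)}
    (hA : Continuous A) (hM : Continuous M) :
    AEStronglyMeasurable (fun x => dirTopEig (A x) (M x)) volume := by
  refine aestronglyMeasurable_of_tendsto_ae (𝓝[>] (0 : ℝ))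
    (f := fun (τ : ℝ) x => (lam (A x + τ • M x) - lam (A x)) / τ) (fun τ => ?_)
    (ae_of_all _ fun x => tendsto_lam_line_slope (A x) (M x))
  exact (((continuous_lam.comp (hA.add (hM.const_smul τ))).sub
    (continuous_lam.comp hA)).div_const τ).aestronglyMeasurable

/-- **The Danskin density `x ↦ q λ₁^{q−1} μ(S(x); M(x))` is integrable** for smooth divergence-free
`v`, real `q ≥ 1` and every continuous direction field `M` (dominated by the continuous
`q λ₁^{q−1} ‖M‖`). [ours] -/
theorem integrable_topEigDensity {q : ℝ} (hq : 1 ≤ q) {v : UnitAddTorus d → EuclideanSpace ℝ d}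
    (hv : Torus.IsSmooth v) (hdv : Torus.IsDivFree v)
    {M : UnitAddTorus d → EuclideanSpace ℝ (d × d)} (hM : Continuous M) :
    Integrable (fun x => q * torusStrainTopEig v x ^ (q - 1) *
      dirTopEig (strainFlat v x) (M x)) volume := by
  have h1 : Continuous fun x => q * torusStrainTopEig v x ^ (q - 1) :=
    continuous_const.mul ((continuous_torusStrainTopEig hv).rpow_const fun _ => Or.inr (by linarith))
  refine Integrable.mono' (h1.mul hM.norm).integrable_unitAddTorus
    (h1.aestronglyMeasurable.mul (aestronglyMeasurable_dirTopEig_comp (continuous_strainFlat hv) hM))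
    (ae_of_all _ fun x => ?_)
  have hl : 0 ≤ torusStrainTopEig v x := by
    rw [← lam_strainFlat]; exact lam_strainFlat_nonneg hv hdv x
  have hc : 0 ≤ q * torusStrainTopEig v x ^ (q - 1) := mul_nonneg (by linarith) (Real.rpow_nonneg hl _)
  rw [Real.norm_eq_abs, abs_mul, abs_of_nonneg hc]
  exact mul_le_mul_of_nonneg_left (abs_dirTopEig_le_norm _ _) hc

/-! ## 2. The compatible-selection inequality (LEMMA S (c)) -/

omit [DecidableEq d] [Nonempty d] in
/-- **`ν μ(A; L) + eᵀXe ≤ μ(A; νL + X)`** for a top vector `e` of `A` that maximises the heat form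
`eᵀLe = μ(A; L)`, and every real `ν` (test `νL + X` with `e`). [ours] -/
theorem dirTopEig_smul_add_ge {A L X : EuclideanSpace ℝ (d × d)} {e : d → ℝ} (he : e ∈ topEigSet A)
    (hL : quad L e = dirTopEig A L) (ν : ℝ) :
    ν * dirTopEig A L + quad X e ≤ dirTopEig A (ν • L + X) := by
  have h := quad_le_dirTopEig (ν • L + X) he
  rwa [quad_add, quad_smul, hL] at h

/-! ## 3. The Euler strain tendency, heat-maximal selections, the selection production -/

omit [Fintype d] [Nonempty d] in
/-- The pressure-Hessian vector ignores additive constants in the pressure. [folklore] -/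
theorem pressVec_sub_const (P : UnitAddTorus d → ℝ) (c : ℝ) (y : UnitAddTorus d) :
    pressVec (fun x => P x - c) y = pressVec P y := by
  have h : ∀ j, Torus.partialDeriv j (fun x => P x - c) = Torus.partialDeriv j P := fun j => by
    funext x
    simp only [Torus.partialDeriv, Torus.lineDeriv]
    rw [deriv_sub_const]
  ext q
  rw [pressVec_apply, pressVec_apply, h q.2]

/-- **The Euler strain tendency at a datum**: `E_w(x) = −Π(π_w)(x) − N(w)(x) − Σₖ wₖ(x) ∂ₖS(w)(x)`
with the datum's own pressure `π_w = pressureOf w` — the value of `Ṡ` at `t = 0⁺`, `ν = 0`, along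
the flow issued from `w` (`timeDerivWithin_strainFlat_eq`). [ours, bookkeeping] -/
def eulerStrainVec (w : UnitAddTorus d → EuclideanSpace ℝ d) (x : UnitAddTorus d) :
    EuclideanSpace ℝ (d × d) :=
  -pressVec (pressureOf w) x - nonlinVec w x - ∑ k, w x k • Torus.partialDeriv k (strainFlat w) x

omit [Nonempty d] in
/-- The Euler strain tendency of a smooth datum is continuous. [ours] -/
theorem continuous_eulerStrainVec {w : UnitAddTorus d → EuclideanSpace ℝ d} (hw : Torus.IsSmooth w) :
    Continuous (eulerStrainVec w) := by
  have h1 : Continuous (pressVec (pressureOf w)) := (isSmooth_pressVec (isSmooth_pressureOf hw)).continuous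
  have h2 : Continuous (nonlinVec w) := (isSmooth_nonlinVec hw).continuous
  have h3 : Continuous fun x => ∑ k, w x k • Torus.partialDeriv k (strainFlat w) x :=
    continuous_finsetSum _ fun k _ =>
      (hw.apply k).continuous.smul ((isSmooth_strainFlat hw).partialDeriv k).continuous
  exact (h1.neg.sub h2).sub h3

/-- **Heat-maximal top selection**: `e(x)` is a unit top vector of `S(w)(x)` (`e x ∈ topEigSet`) AND
maximises the heat form there, `e(x)ᵀ S(Δw)(x) e(x) = μ(S(w)(x); S(Δw)(x))`. No measurability or
regularity is part of the notion (the production below carries its own integrability hypothesis).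
[ours, bookkeeping; QN4-NOTE LEMMA S (c) "max-heat-compatible"] -/
structure IsHeatMaxSelection (w : UnitAddTorus d → EuclideanSpace ℝ d) (e : UnitAddTorus d → d → ℝ) :
    Prop where
  top : ∀ x, e x ∈ topEigSet (strainFlat w x)
  heat : ∀ x, quad (strainFlat (Torus.laplacian w) x) (e x) =
    dirTopEig (strainFlat w x) (strainFlat (Torus.laplacian w) x)

/-- Heat-maximal top selections exist at every datum (`μ` is attained on the top eigen-set).
[ours] -/
theorem exists_isHeatMaxSelection (w : UnitAddTorus d → EuclideanSpace ℝ d) :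
    ∃ e, IsHeatMaxSelection w e := by
  choose e he hq using fun x =>
    exists_quad_eq_dirTopEig (strainFlat w x) (strainFlat (Torus.laplacian w) x)
  exact ⟨e, ⟨he, hq⟩⟩

/-- **The Euler production of `Φ_q` through a selection**:
`𝒫_q(w; e) = ∫ q λ₁(x)^{q−1} e(x)ᵀ E_w(x) e(x) dx`. Search for candidate a priori estimates; no
regularity claim — a static functional of the datum and the selection. [ours, bookkeeping] -/
def selEulerProduction (q : ℝ) (w : UnitAddTorus d → EuclideanSpace ℝ d) (e : UnitAddTorus d → d → ℝ) :
    ℝ :=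
  ∫ x, q * torusStrainTopEig w x ^ (q - 1) * quad (eulerStrainVec w x) (e x)

/-! ## 4. LEMMA S (ii): the selection production bounds the Danskin rate from below -/

/-- **LEMMA S (ii), datum level.** For smooth divergence-free `w`, real `q ≥ 1`, a heat-maximal
selection `e` with integrable production density, and every real `ν`:
`𝒫_q(w; e) − ν · heatDissipation Φ_q w ≤ ∫ q λ₁^{q−1} μ(S(w); ν S(Δw) + E_w)`
(Danskin's formula `heatDissipation Φ_q w = −∫ q λ₁^{q−1} μ(S; S(Δw))` and the selection inequality
pointwise). [ours; QN4-NOTE LEMMA S (ii)] -/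
theorem selEulerProduction_sub_heat_le_integral {q : ℝ} (hq : 1 ≤ q)
    {w : UnitAddTorus d → EuclideanSpace ℝ d} (hw : Torus.IsSmooth w) (hdw : Torus.IsDivFree w)
    {e : UnitAddTorus d → d → ℝ} (he : IsHeatMaxSelection w e)
    (hint : Integrable (fun x => q * torusStrainTopEig w x ^ (q - 1) *
      quad (eulerStrainVec w x) (e x)) volume) (ν : ℝ) :
    selEulerProduction q w e - ν * heatDissipation (torusTopEigMoment q) w ≤
      ∫ x, q * torusStrainTopEig w x ^ (q - 1) *
        dirTopEig (strainFlat w x) (ν • strainFlat (Torus.laplacian w) x + eulerStrainVec w x) := by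
  have hheat := integrable_danskinDensity hq hw hw.laplacian hdw
  have hrhs : Integrable (fun x => q * torusStrainTopEig w x ^ (q - 1) *
      dirTopEig (strainFlat w x) (ν • strainFlat (Torus.laplacian w) x + eulerStrainVec w x)) volume :=
    integrable_topEigDensity hq hw hdw
      (((continuous_strainFlat hw.laplacian).const_smul ν).add (continuous_eulerStrainVec hw))
  rw [heatDissipation_topEigMoment_eq_integral hq hw hdw, selEulerProduction, mul_neg, sub_neg_eq_add,
    ← integral_const_mul, ← integral_add hint (hheat.const_mul ν)]
  refine integral_mono (hint.add (hheat.const_mul ν)) hrhs fun x => ?_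
  have hl : 0 ≤ torusStrainTopEig w x := by
    rw [← lam_strainFlat]; exact lam_strainFlat_nonneg hw hdw x
  have hc : 0 ≤ q * torusStrainTopEig w x ^ (q - 1) := mul_nonneg (by linarith) (Real.rpow_nonneg hl _)
  have hpt := dirTopEig_smul_add_ge (X := eulerStrainVec w x) (he.top x) (he.heat x) ν
  calc q * torusStrainTopEig w x ^ (q - 1) * quad (eulerStrainVec w x) (e x) +
        ν * (q * torusStrainTopEig w x ^ (q - 1) *
          dirTopEig (strainFlat w x) (strainFlat (Torus.laplacian w) x))
        = q * torusStrainTopEig w x ^ (q - 1) *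
          (ν * dirTopEig (strainFlat w x) (strainFlat (Torus.laplacian w) x) +
            quad (eulerStrainVec w x) (e x)) := by ring
    _ ≤ q * torusStrainTopEig w x ^ (q - 1) *
          dirTopEig (strainFlat w x) (ν • strainFlat (Torus.laplacian w) x + eulerStrainVec w x) :=
        mul_le_mul_of_nonneg_left hpt hc

/-- **LEMMA S (i)+(ii) along Navier–Stokes.** Along a classical solution of unforced Navier–Stokes
(`ν` real) on `T^d × [a, b]`, `a < b`, with `q ≥ 1` and a heat-maximal selection `e` for the slice
`u a` whose production density is integrable: `s ↦ Φ_q(u s)` has at `s = a` the right derivative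
value `R = ∫ q λ₁^{q−1} μ(S(u a); ν S(Δ u a) + E_{u a})` within `[a, b]`
(`hasDerivWithinAt_topEigMoment_navierStokes_Icc`; the solution's pressure Hessian is that of
`pressureOf (u a)`, `pressureOf_eq_pressure_sub_integral`), and
`𝒫_q(u a; e) − ν · heatDissipation Φ_q (u a) ≤ R`. [ours; QN4-NOTE LEMMA S] -/
theorem selEulerProduction_sub_heat_le_initialRate {q : ℝ} (hq : 1 ≤ q) {a b ν : ℝ} (hab : a < b)
    {u : ℝ → UnitAddTorus d → EuclideanSpace ℝ d} {p : ℝ → UnitAddTorus d → ℝ}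
    (h : Torus.IsClassicalNSSolutionOn (Icc a b) ν 0 u p)
    {e : UnitAddTorus d → d → ℝ} (he : IsHeatMaxSelection (u a) e)
    (hint : Integrable (fun x => q * torusStrainTopEig (u a) x ^ (q - 1) *
      quad (eulerStrainVec (u a) x) (e x)) volume) :
    ∃ R : ℝ, HasDerivWithinAt (fun s => torusTopEigMoment q (u s)) R (Icc a b) a ∧
      selEulerProduction q (u a) e - ν * heatDissipation (torusTopEigMoment q) (u a) ≤ R := by
  have ha : a ∈ Icc a b := left_mem_Icc.2 hab.le
  have hw : Torus.IsSmooth (u a) := h.smooth_velocity.isSmooth_slice ha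
  have hdw : Torus.IsDivFree (u a) := h.divFree a ha
  have hP : ∀ x, pressVec (p a) x = pressVec (pressureOf (u a)) x := fun x => by
    rw [pressureOf_eq_pressure_sub_integral h hab ha, pressVec_sub_const]
  have hdir : ∀ x, ν • Torus.laplacian (strainFlat (u a)) x - pressVec (p a) x +
      strainFlat ((0 : ℝ → UnitAddTorus d → EuclideanSpace ℝ d) a) x - nonlinVec (u a) x -
      ∑ k, u a x k • Torus.partialDeriv k (strainFlat (u a)) x =
      ν • strainFlat (Torus.laplacian (u a)) x + eulerStrainVec (u a) x := fun x => by
    rw [← strainFlat_laplacian hw x, hP x, Pi.zero_apply, strainFlat_zero, eulerStrainVec]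
    abel
  refine ⟨_, (hasDerivWithinAt_topEigMoment_navierStokes_Icc hab h hq).congr_deriv
    (integral_congr_ae (ae_of_all _ fun x => by simp only [hdir x])),
    selEulerProduction_sub_heat_le_integral hq hw hdw he hint ν⟩

end TopEig

/-! ## 5. Lemma 0 (⇒) for the one-sided law, and the static door for the `λ₁` rows -/

open TopEig

variable {d : Type*} [Fintype d] [DecidableEq d]

/-- **Lemma 0 (⇒) for `SaturatingLawSup`, general functional.** If `SaturatingLawSup F σ γ κ` holds
and, at a smooth divergence-free zero-mean datum `u₀` on `T³` and a viscosity `ν > 0`, the number `L`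
lies below SOME right derivative value of `s ↦ F(u s)` at the initial time along EVERY zero-mean
classical solution issued from `u₀`, then `L ≤ κ ν^{−γ} (2ℰ u₀) F(u₀)^{1+1/σ}` (local existence,
`Torus.exists_classicalNS_smooth`; mean conservation). [ours; SIEVELD §0 Lemma 0 (⇒), one-sided form] -/
theorem SaturatingLawSup.lowerRate_le {F : (UnitAddTorus d → EuclideanSpace ℝ d) → ℝ} {σ γ κ : ℝ}
    (h : SaturatingLawSup (d := d) F σ γ κ) (hd : Fintype.card d = 3) {ν : ℝ} (hν : 0 < ν)
    {u₀ : UnitAddTorus d → EuclideanSpace ℝ d} (hu₀ : Torus.IsSmooth u₀) (hdiv : Torus.IsDivFree u₀)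
    (hmean : Torus.HasZeroMean u₀) {L : ℝ}
    (hL : ∀ ⦃T : ℝ⦄, 0 < T → ∀ ⦃u : ℝ → UnitAddTorus d → EuclideanSpace ℝ d⦄ ⦃p : ℝ → UnitAddTorus d → ℝ⦄,
      Torus.IsClassicalNSSolutionOn (Icc 0 T) ν 0 u p → u 0 = u₀ →
      (∀ t ∈ Icc 0 T, Torus.HasZeroMean (u t)) →
      ∃ R : ℝ, HasDerivWithinAt (fun s => F (u s)) R (Icc 0 T) 0 ∧ L ≤ R) :
    L ≤ κ * ν ^ (-γ) * (2 * torusEnstrophy u₀) * F u₀ ^ (1 + σ⁻¹) := by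
  obtain ⟨T, hT, u, p, hsol, hu0, -⟩ := Torus.exists_classicalNS_smooth (d := d) hd.le hν.le hu₀ hdiv
  have hmean' : ∀ t ∈ Icc 0 T, Torus.HasZeroMean (u t) := fun t ht =>
    hsol.hasZeroMean_of_hasZeroMean (convex_Icc 0 T) (left_mem_Icc.2 hT.le) ht (by rw [hu0]; exact hmean)
  obtain ⟨R, hR, hLR⟩ := hL hT hsol hu0 hmean'
  have hle := h hd hν hT hsol hmean' 0 (left_mem_Icc.2 hT.le) R hR
  rw [hu0] at hle
  exact hLR.trans hle

/-- **The static necessary condition for the `λ₁` rows.** Under `SaturatingLawSup Φ_q σ γ κ` on `T³`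
(`q ≥ 1`): at every smooth divergence-free zero-mean datum `w`, every heat-maximal selection `e`
with integrable production density and every `ν > 0`,
`𝒫_q(w; e) − ν · heatDissipation Φ_q w ≤ κ ν^{−γ} (2ℰ w) Φ_q(w)^{1+1/σ}`.
[ours; SIEVELD §0 Lemma 0 (⇒) + QN4-NOTE LEMMA S] -/
theorem SaturatingLawSup.selEulerProduction_sub_heat_le {q σ γ κ : ℝ} (hq : 1 ≤ q)
    (hd : Fintype.card d = 3)
    (h : SaturatingLawSup (d := d) (torusTopEigMoment q) σ γ κ) {ν : ℝ} (hν : 0 < ν)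
    {w : UnitAddTorus d → EuclideanSpace ℝ d} (hw : Torus.IsSmooth w) (hdw : Torus.IsDivFree w)
    (hmean : Torus.HasZeroMean w) {e : UnitAddTorus d → d → ℝ} (he : IsHeatMaxSelection w e)
    (hint : Integrable (fun x => q * torusStrainTopEig w x ^ (q - 1) *
      quad (eulerStrainVec w x) (e x)) volume) :
    selEulerProduction q w e - ν * heatDissipation (torusTopEigMoment q) w ≤
      κ * ν ^ (-γ) * (2 * torusEnstrophy w) * torusTopEigMoment q w ^ (1 + σ⁻¹) := by
  haveI : Nonempty d := Fintype.card_pos_iff.1 (by omega)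
  refine h.lowerRate_le hd hν hw hdw hmean fun T hT u p hsol hu0 _ => ?_
  subst hu0
  exact selEulerProduction_sub_heat_le_initialRate hq hT hsol he hint

/-- **The static door at one constant** (`λ₁` rows): ONE viscosity `ν > 0`, ONE smooth
divergence-free zero-mean datum `w` on `T³` and ONE heat-maximal selection `e` (integrable production
density) with `κ ν^{−γ} (2ℰ w) Φ_q(w)^{1+1/σ} < 𝒫_q(w; e) − ν · heatDissipation Φ_q w`. Search for
candidate a priori estimates; no regularity claim — nothing is asserted. [ours, bookkeeping] -/
def TopEigSelKillAt (q σ γ κ : ℝ) : Prop :=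
  ∃ ν : ℝ, 0 < ν ∧ ∃ w : UnitAddTorus (Fin 3) → EuclideanSpace ℝ (Fin 3),
    Torus.IsSmooth w ∧ Torus.IsDivFree w ∧ Torus.HasZeroMean w ∧
    ∃ e : UnitAddTorus (Fin 3) → Fin 3 → ℝ, IsHeatMaxSelection w e ∧
      Integrable (fun x => q * torusStrainTopEig w x ^ (q - 1) * quad (eulerStrainVec w x) (e x)) volume ∧
      κ * ν ^ (-γ) * (2 * torusEnstrophy w) * torusTopEigMoment q w ^ (1 + σ⁻¹) <
        selEulerProduction q w e - ν * heatDissipation (torusTopEigMoment q) w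

/-- **The static door for every constant** (`λ₁` rows): `TopEigSelKillAt q σ γ κ` for every real `κ`
(QN4-NOTE LEMMA K supplies it on paper from ONE family with a production floor and vanishing heat
cost, by amplitude scaling). Nothing is asserted. [ours, bookkeeping] -/
def TopEigSelKill (q σ γ : ℝ) : Prop :=
  ∀ κ : ℝ, TopEigSelKillAt q σ γ κ

/-- **Door ⇒ kill at one constant**: `TopEigSelKillAt q σ γ κ → ¬ SaturatingLawSup Φ_q σ γ κ` on `T³`
(`q ≥ 1`). Refutation bookkeeping for a CANDIDATE inequality; nothing about regularity. [ours] -/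
theorem not_topEigMoment_saturatingLawSup_of_selKillAt {q σ γ κ : ℝ} (hq : 1 ≤ q)
    (hK : TopEigSelKillAt q σ γ κ) :
    ¬ SaturatingLawSup (d := Fin 3) (torusTopEigMoment q) σ γ κ := by
  intro hlaw
  obtain ⟨ν, hν, w, hw, hdw, hmean, e, he, hint, hlt⟩ := hK
  exact (not_le.2 hlt) (hlaw.selEulerProduction_sub_heat_le hq (by simp) hν hw hdw hmean he hint)

/-- **Door ⇒ kill for every constant**: `TopEigSelKill q σ γ → ∀ κ, ¬ SaturatingLawSup Φ_q σ γ κ`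
on `T³` (`q ≥ 1`) — the kernel half of the no-go seat's verdict chain for the rows
`ES.lam1.q | T_LD` (the other half, an instance of the door, is the pen witness W18). [ours] -/
theorem not_topEigMoment_saturatingLawSup_of_selKill {q σ γ : ℝ} (hq : 1 ≤ q)
    (hK : TopEigSelKill q σ γ) (κ : ℝ) :
    ¬ SaturatingLawSup (d := Fin 3) (torusTopEigMoment q) σ γ κ :=
  not_topEigMoment_saturatingLawSup_of_selKillAt hq (hK κ)

end Summit.NavierStokesRegularity.FunctionalMining

end
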